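import Summits.Ventures.Crystal3D.Theorems.StickyWulffConstantTextureBuildMeshV7
import HarnessLib

/-!
# TB-1: the level-2 composition WITH HEALING — `stub_TB_cover` may build its cover on a HEALED configuration (repair of the curtain exposure)
# (lane T, crux `TextureLiminfV5`, stmt-Ventures-23912; census memo HOME/wulff-p2/g23/TB-COVER-CENSUS-g23.md §F1–§F2)

HONEST FRAMING. Venture `Summits/Ventures/Crystal3D` (cell `crystal3d-full`), route `route-Ventures-StickyWulffConstant`, helper `--supports` the
law-v5 crux `TextureLiminfV5` (stmt-Ventures-23912).  Pure logic over '…TextureBuildMeshV7' (census-free, standard axioms).  No cover is built; F-C1 not moved.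

WHY (census memo §F1, wulff-p2 g23).  The registered `stub_TB_cover` (TexShadow v8.23) asks for a `RiseredCover C R₀ N x`, whose filled configuration `x'`
must CONTAIN `x` (`CellCover.hsub : range x ⊆ range x'`).  A wall cell needs COMPLETE plates of thickness `R₀` at every admissible depth and pays, through
the mesh, `≥ 6(h + 2R₀)/ρ` per unit of certified wall area (designated prism laterals `3·latArea`, `Mesh₅.hPlat`; plus the rim `C(1+h)ρ`), so it needs
`ρ ≳ 6(h + 2R₀)/θ''`; a SUMMABLE curtain of bounded, saturated, unfillable, site-vacating defects flanking a flat non-coaxial wall (in an hcp-type layer: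
move one ball to the adjacent free hollow and delete the two other balls around it — cost `ΔDef = 15`, every ball keeps `≥ 6` contacts, no admissible
point touches `≥ 3` balls; in-plane spacing `s(z) = (2z + 2R₀)/θ''` at depths `z = R₀/2, R₀, 3R₀/2, …`, total cost `≈ 0.12·θ''²` per unit wall area for
`R₀ = 10`) appears to spoil every such plate, for every `N` — an ADVERSARY SKETCH against the consequent of the stub for small `θ` (memo §F1: a census
finding, NOT a kernel refutation; a kernel `¬` would need the lower bound over all covers/meshes and the two antecedents `BarlowResolution`,
`BarlowAdhesionTCap`).  The field `hsub` is used by NO consumer in the tree (the energy assembly and the discrete half `tentBudget_add_chargeSum_le₃_slack`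
only use `hDef`), so the cheap insurance is to let the cover HEAL the configuration first: replace sparse bounded defects by lattice balls (`Def` does not
increase; the count drops by `o(N)`), then cover the healed packing.  This file is the turnkey glue for that optional re-typing:

* `CoverH Adh` — the HEALED binder shape: `… → ∃ (N' x' δ'), (1 − δ)N ≤ (1 − δ')N' ∧ 6N' − b(x') ≤ 6N − b(x) ∧ ∃ (rc : RiseredCover C R₀ N' x')
  (μ : Mesh₇ rc δ'), tilingLoss₂ + rimSum + gapCost ≤ θ·N^{2/3} + unownedSlack₃` (proposed v8.24 text of `stub_TB_cover`, antecedents unchanged);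
* `coverH_of_cover` — the registered v8.23 shape IMPLIES the healed shape (`N' := N`, `x' := x`, `δ' := δ`): the re-typing is a WEAKENING;
* **`shadowTheoremSatAtomicV5_of_healed₇_slack`** / **`textureBuildH₇_of_stubs`** — healed TB-cover + the UNCHANGED `stub_TB_energy` binder + the wall law
  ⇒ `ShadowTheoremSatAtomicV5` / `ShadowTheoremSatV5` (same proof as `shadowTheoremSatAtomicV5_of_risered₇R_slack`, the energy theorem applied to the healed
  packing: mass `(1 − δ')N' ≥ (1 − δ)N`, energy `≤ Def(x') + slack ≤ Def(x) + θ·N^{2/3}`).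
WHAT THIS IS NOT: no statement about the truth of the healed stub (the multi-grain constructor stays XL: grains of the resolution, healing of bounded junk,
wall cells at a good scale, riser boxes); F-C1 not moved.
-/

noncomputable section

open scoped BigOperators InnerProductSpace
open MeasureTheory

namespace Summit.Ventures.Crystal3D.Cruxes.TextureLiminf.TexShadow

open Summit.Ventures.Crystal3D Summit.Ventures.Crystal3D.Theorems

/-- **THE HEALED BINDER SHAPE of `stub_TB_cover`** (proposed v8.24 text, antecedents `BarlowResolution → Adh →` as registered with `Adh := BarlowAdhesionTCap`):
the cover is built on a HEALED packing `x'` of `N'` balls with no larger deficiency and `(1 − δ)N ≤ (1 − δ')N'`. -/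
def CoverH (Adh : Prop) : Prop :=
  BarlowResolution → Adh →
    ∀ C R₀ : ℝ, 1 ≤ R₀ → ∀ K δ θ : ℝ, 0 < δ → 0 < θ → ∃ N₀ : ℕ, ∀ N : ℕ, N₀ ≤ N → ∀ x : Fin N → E3, IsUnitPacking x →
      IsSaturated x → 6 * (N : ℝ) - (numContacts x : ℝ) ≤ K * (N : ℝ) ^ ((2 : ℝ) / 3) →
      ∃ (N' : ℕ) (x' : Fin N' → E3) (δ' : ℝ), (1 - δ) * (N : ℝ) ≤ (1 - δ') * (N' : ℝ) ∧
        6 * (N' : ℝ) - (numContacts x' : ℝ) ≤ 6 * (N : ℝ) - (numContacts x : ℝ) ∧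
        ∃ (rc : RiseredCover C R₀ N' x') (μ : Mesh₇ rc δ'),
          rc.tilingLoss₂ + rc.rimSum + μ.gapCost ≤ θ * (N : ℝ) ^ ((2 : ℝ) / 3) + rc.unownedSlack₃

/-- **The registered (v8.23) binder shape implies the healed one** — the re-typing is a weakening (`N' := N`, `x' := x`, `δ' := δ`). -/
theorem coverH_of_cover {Adh : Prop}
    (hcover : BarlowResolution → Adh →
      ∀ C R₀ : ℝ, 1 ≤ R₀ → ∀ K δ θ : ℝ, 0 < δ → 0 < θ → ∃ N₀ : ℕ, ∀ N : ℕ, N₀ ≤ N → ∀ x : Fin N → E3, IsUnitPacking x →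
        IsSaturated x → 6 * (N : ℝ) - (numContacts x : ℝ) ≤ K * (N : ℝ) ^ ((2 : ℝ) / 3) →
        ∃ (rc : RiseredCover C R₀ N x) (μ : Mesh₇ rc δ),
          rc.tilingLoss₂ + rc.rimSum + μ.gapCost ≤ θ * (N : ℝ) ^ ((2 : ℝ) / 3) + rc.unownedSlack₃) :
    CoverH Adh := by
  intro hres hadh C R₀ hR₀ K δ θ hδ hθ
  obtain ⟨N₀, hN₀⟩ := hcover hres hadh C R₀ hR₀ K δ θ hδ hθ
  refine ⟨N₀, fun N hN x hx hsat hK => ?_⟩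
  obtain ⟨rc, μ, h⟩ := hN₀ N hN x hx hsat hK
  exact ⟨N, x, δ, le_rfl, le_rfl, rc, μ, h⟩

/-- **THE LEVEL-2 COMPOSITION WITH HEALING** (mesh v7, slack form, regime `1 ≤ R₀`; adhesion hypothesis arbitrary): the HEALED TB-cover + the unchanged
TB-energy binder + the wall law ⇒ the atomic-scale saturated shadow theorem.  `energy ≤ Def(x') + tilingLoss₂ + rimSum + gapCost − unownedSlack₃ ≤
Def(x) + θN^{2/3}` and `(1 − δ)N ≤ (1 − δ')N' ≤ √2·vol`. -/
theorem shadowTheoremSatAtomicV5_of_healed₇_slack {Adh : Prop} (hcover : CoverH Adh)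
    (henergy : PolytopeCalculus → BarlowFreeCertificate →
      ∀ (C R₀ : ℝ), 1 ≤ R₀ → ∀ (N : ℕ) (x : Fin N → E3) (δ : ℝ) (rc : RiseredCover C R₀ N x) (μ : Mesh₇ rc δ),
        ∃ (n : ℕ) (G : Fin n → Set E3) (A : Fin n → (E3 ≃ₗᵢ[ℝ] E3)) (c : Fin n → Fin n → ℝ) (m : Fin n → Fin n → E3),
          IsTexture (13 / 25) (1 / 2) n G A c m ∧ (1 - δ) * (N : ℝ) ≤ Real.sqrt 2 * vol n G ∧
          energy n G A c m ≤ rc.tentBudget + rc.chargeSum + rc.riserSum + μ.gapCost) :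
    BarlowResolution → Adh → BilayerWallV5 → PolytopeCalculus → BarlowFreeCertificate → ShadowTheoremSatAtomicV5 := by
  intro hres hadh hBW hpoly hfree _hG _hC _hNRG _hSL K δ θ hδ hθ
  obtain ⟨C, R₀, hR₀, hW⟩ := hBW
  obtain ⟨N₀, hN₀⟩ := hcover hres hadh C R₀ hR₀ K δ θ hδ hθ
  refine ⟨N₀, fun N hN x hx hsat hK => ?_⟩
  obtain ⟨N', x', δ', hmass', hDef', rc, μ, hslack⟩ := hN₀ N hN x hx hsat hK
  obtain ⟨n, G, A, c, m, hT, hvol, hEn⟩ := henergy hpoly hfree C R₀ hR₀ N' x' δ' rc μ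
  refine ⟨n, G, A, c, m, hT, hmass'.trans hvol, ?_⟩
  have hdisc := rc.tentBudget_add_chargeSum_le₃_slack hR₀ hW
  linarith

/-- **THE COMPOSITION OF RECORD WITH HEALING**: healed TB-cover + TB-energy ⇒ the registered shape of `stub_textureBuild`. -/
theorem textureBuildH₇_of_stubs {Adh : Prop} (hcover : CoverH Adh)
    (henergy : PolytopeCalculus → BarlowFreeCertificate →
      ∀ (C R₀ : ℝ), 1 ≤ R₀ → ∀ (N : ℕ) (x : Fin N → E3) (δ : ℝ) (rc : RiseredCover C R₀ N x) (μ : Mesh₇ rc δ),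
        ∃ (n : ℕ) (G : Fin n → Set E3) (A : Fin n → (E3 ≃ₗᵢ[ℝ] E3)) (c : Fin n → Fin n → ℝ) (m : Fin n → Fin n → E3),
          IsTexture (13 / 25) (1 / 2) n G A c m ∧ (1 - δ) * (N : ℝ) ≤ Real.sqrt 2 * vol n G ∧
          energy n G A c m ≤ rc.tentBudget + rc.chargeSum + rc.riserSum + μ.gapCost) :
    BarlowResolution → Adh → BilayerWallV5 → PolytopeCalculus → BarlowFreeCertificate → ShadowTheoremSatV5 :=
  textureBuild_of_atomic (shadowTheoremSatAtomicV5_of_healed₇_slack hcover henergy)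

/-- **THE TB SUB-LINE BY NAME, HEALED FORM**: healed TB-cover + T0 + the riser package ⇒ `ShadowTheoremSatV5` (given the three line-level hypotheses) —
drop-in replacement of `textureBuildR₇R_of_riserPackage` for the v8.24 derivation
`stub_textureBuildAtomic := shadowTheoremSatAtomicV5_of_healed₇_slack stub_TB_cover stub_TB_energy`. -/
theorem textureBuildH₇_of_riserPackage {Adh : Prop} (hcover : CoverH Adh) (hT0 : BarlowFreeCertificateCover) (hB6 : RiserPackage₇) :
    BarlowResolution → Adh → BilayerWallV5 → PolytopeCalculus → BarlowFreeCertificate → ShadowTheoremSatV5 :=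
  textureBuildH₇_of_stubs hcover (tb_energy_of_riserPackage₇ hT0 hB6)

end Summit.Ventures.Crystal3D.Cruxes.TextureLiminf.TexShadow

end
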